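import Literature.NumberTheory.ModularForms.BinaryQuadGaussSumBasic
import HarnessLib

/-!
# Gauss sums of binary quadratic forms, III: the degenerate case — the twisted sum on the
# lattice `s ∣ adj(M)w`, and vanishing off it

Topic `NumberTheory/ModularForms` (namespace `Literature.NumberTheory.ModularForms`), continuing
`BinaryQuadGaussSum.lean` / `BinaryQuadGaussSumBasic.lean` (the sum
`binQuadGaussSum c f a w₁ w₂ = G(a, c; f, w) = ∑_{x,y mod c} e((a f(x,y) + w₁x + w₂y)/c)` of the
binary form `f = (A, B, C)`). Everything here is PROVED (theorems only; no definition, no named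
fact). Notation: `M = (2A B; B 2C)` the Gram matrix of `f` (`f(v) = ½vᵀMv`, `det M = 4AC − B²
= −D`), `adj M = (2C −B; −B 2A)` (`M·adj M = −D·1`), `f̃ = (C, −B, A)` the adjoint form
(`f̃(w) = ½wᵀ(adj M)w`, properly equivalent to `f`).

`BinaryQuadGaussSumBasic.binQuadGaussSum_eq_stdAddChar_mul` completes the square when `D` is a
unit mod `c`. This file treats the DEGENERATE case needed at the cusps `a/c` with
`s = (c, −D) > 1` of a theta series of level `−D` (Conrey–Iwaniec 2002, Propositions 3.2/3.3:
`c ≥ 1` arbitrary, `s = (c, q)`, `r = q/s`, `(r, c) = 1` for `q` squarefree):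

* `binQuadGaussSum_eq_stdAddChar_mul_of_gram_solution` — completing the square from ANY
  solution `t` of `a·M t = w (mod c)`: `G(a,c;f,w) = e(−a f(t)/c)·G(a,c;f,0)`.
* `binQuadGaussSum_eq_of_dvd_adj` — **the lattice case**: write `−D = r·s` with `r` a unit
  mod `c` (`r r̄ ≡ 1`) and `a ā ≡ 1`; if `s ∣ adj(M)w` (both coordinates) then
  `t = ā r̄ · adj(M)w/s` solves `a·M t ≡ w` (as `M·adj M = rs`), so
  `G(a,c;f,w) = e(−ā r̄² f(adj(M)w/s)/c)·G(a,c;f,0)`, and, when `(r, s) = 1`,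
  `= e(−ā r̄·(f̃(w)/s)/c)·G(a,c;f,0)` (`binQuadGaussSum_eq_of_dvd_adj'`; `s²f(adj(M)w/s) =
  f(adj(M)w) = rs·f̃(w)`, so `s ∣ f̃(w)` and `f(adj(M)w/s) = r·f̃(w)/s`).
* `binQuadGaussSum_eq_zero_of_dvd_fst/snd` — **vanishing off the lattice**: if some `p` divides
  `c` and `D` but not `adj(M)w` (some coordinate), then `G(a,c;f,w) = 0` for EVERY `a`: with
  `u` the column of `adj M` having `w·u ≢ 0 (p)` one has `Mu ∈ {(−D,0),(0,−D)} ≡ 0 (p)` and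
  `f(u) ∈ {−CD, −AD}`, so the translation `v ↦ v + (c/p)u` fixes `a f(v) mod c` and multiplies
  the sum by `e(w·u/p) ≠ 1`. For squarefree `s ∣ (c, D)`: `¬(s ∣ adj(M)w) ⇒ G = 0`
  (`binQuadGaussSum_eq_zero_of_not_dvd_adj`).

Together: for `s` squarefree, `s ∣ c`, `−D = rs`, `(r, c) = 1`, the twisted sums `G(a,c;f,w)`,
`w ∈ ℤ²`, are supported on the index-`s` lattice `L_s = {w : s ∣ adj(M)w} = Mℤ² + sℤ²` and there
equal `e(−ā r̄·f̃(w)/s / c)·G(a,c;f,0)` — the "thinning" of the dual lattice and the phase that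
turn the Poisson-dual of `θ_f` at the cusp `a/c` into the theta series of the form `f̃/s` on `L_s`
at `−ā r̄/c` (the `d ≡ (ar)‾ (mod c)` of Conrey–Iwaniec (3.16)). No parity or `(A, c) = 1`
hypothesis; the modulus `|G(a,c;f,0)| = c√s` is in the sequel files of this series
(`BinaryQuadGaussSumValues.lean`).

## References

* A. N. Andrianov, V. G. Zhuravlev, *Modular Forms and Hecke Operators*, AMS (1995/2015), Ch. 1
  §4.3, proof of Proposition 4.5, (4.13)–(4.14) (completing the square / the characteristic of
  the inverted theta series) [AndrianovZhuravlev2015].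
* B. Conrey, H. Iwaniec, Acta Arith. 103 (2002) 259–312, §3 (3.16)–(3.17): `s = (c,q)`, `r = q/s`,
  `d ≡ (ar)‾ (mod c)`, and the twist by the genus character of `s` [ConreyIwaniec2002].
-/

noncomputable section

open Complex Finset

namespace Literature.NumberTheory.ModularForms

open Literature.NumberTheory.QuadraticFields.Quadratic (BinQF)

variable {c : ℕ} [NeZero c]

/-! ### Completing the square from a solution of `a·M t = w` -/

/-- **Completing the square, general form.** If `t = (t₁, t₂)` solves `a·(2A t₁ + B t₂) = w₁`,
`a·(B t₁ + 2C t₂) = w₂` in `ℤ/c` (i.e. `a·M t = w`), then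
`G(a, c; f, w) = e(−a f(t)/c) · G(a, c; f, 0)`: indeed `a f(v + t) = a f(v) + w·v + a f(t)`, and
`v ↦ v + t` is a bijection of `(ℤ/c)²`. (The step behind loc. cit. (4.13)–(4.14); for `D` a unit
mod `c` the solution is `t = ā·M⁻¹w`, `BinaryQuadGaussSumBasic.binQuadGaussSum_eq_stdAddChar_mul`.)
[cite: AndrianovZhuravlev2015, Ch. 1 §4.3, proof of Proposition 4.5 ((4.13)–(4.14))] -/
theorem binQuadGaussSum_eq_stdAddChar_mul_of_gram_solution (f : BinQF) (a w₁ w₂ t₁ t₂ : ZMod c)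
    (h1 : a * (2 * (f.a : ZMod c) * t₁ + (f.b : ZMod c) * t₂) = w₁)
    (h2 : a * ((f.b : ZMod c) * t₁ + 2 * (f.c : ZMod c) * t₂) = w₂) :
    binQuadGaussSum c f a w₁ w₂ =
      (ZMod.stdAddChar
          (-(a * ((f.a : ZMod c) * t₁ ^ 2 + (f.b : ZMod c) * t₁ * t₂ + (f.c : ZMod c) * t₂ ^ 2))) : ℂ) *
        binQuadGaussSum c f a 0 0 := by
  set α : ZMod c := (f.a : ZMod c) with hα
  set β : ZMod c := (f.b : ZMod c) with hβ
  set γ : ZMod c := (f.c : ZMod c) with hγ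
  have key : ∀ v : ZMod c × ZMod c,
      a * (α * v.1 ^ 2 + β * v.1 * v.2 + γ * v.2 ^ 2) + w₁ * v.1 + w₂ * v.2 =
        -(a * (α * t₁ ^ 2 + β * t₁ * t₂ + γ * t₂ ^ 2)) +
          (a * (α * (v.1 + t₁) ^ 2 + β * (v.1 + t₁) * (v.2 + t₂) + γ * (v.2 + t₂) ^ 2) +
            0 * (v.1 + t₁) + 0 * (v.2 + t₂)) := by
    intro v
    linear_combination (-v.1) * h1 + (-v.2) * h2
  rw [binQuadGaussSum_def, binQuadGaussSum_def, Finset.mul_sum]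
  refine Fintype.sum_equiv (Equiv.addRight (t₁, t₂)) _ _ fun v ↦ ?_
  rw [Equiv.coe_addRight, Prod.fst_add, Prod.snd_add, key v, AddChar.map_add_eq_mul]

/-! ### The lattice case `s ∣ adj(M)w` -/

/-- `M · adj(M) = (4AC − B²)·1`, first row: `2A(2Cw₁ − Bw₂) + B(−Bw₁ + 2Aw₂) = (4AC − B²)w₁`.
[folklore] -/
private theorem gram_mul_adj_fst (A B C w₁ w₂ : ℤ) :
    2 * A * (2 * C * w₁ - B * w₂) + B * (-B * w₁ + 2 * A * w₂) = (4 * A * C - B ^ 2) * w₁ := by ring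

/-- `M · adj(M) = (4AC − B²)·1`, second row: `B(2Cw₁ − Bw₂) + 2C(−Bw₁ + 2Aw₂) = (4AC − B²)w₂`.
[folklore] -/
private theorem gram_mul_adj_snd (A B C w₁ w₂ : ℤ) :
    B * (2 * C * w₁ - B * w₂) + 2 * C * (-B * w₁ + 2 * A * w₂) = (4 * A * C - B ^ 2) * w₂ := by ring

/-- `f(adj(M)w) = (4AC − B²)·f̃(w)`: `A(2Cw₁−Bw₂)² + B(2Cw₁−Bw₂)(−Bw₁+2Aw₂) + C(−Bw₁+2Aw₂)²
= (4AC − B²)(Cw₁² − Bw₁w₂ + Aw₂²)`. [folklore] -/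
private theorem eval_adj (A B C w₁ w₂ : ℤ) :
    A * (2 * C * w₁ - B * w₂) ^ 2 + B * (2 * C * w₁ - B * w₂) * (-B * w₁ + 2 * A * w₂) +
        C * (-B * w₁ + 2 * A * w₂) ^ 2 =
      (4 * A * C - B ^ 2) * (C * w₁ ^ 2 - B * w₁ * w₂ + A * w₂ ^ 2) := by ring

/-- **The twisted Gauss sum on the lattice `s ∣ adj(M)w` (degenerate completing of the square).**
Let `f = (A,B,C)` with `4AC − B² = r·s` (`s ≥ 1`), `a ā = 1` and `r r̄ = 1` in `ℤ/c`, and let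
`w ∈ ℤ²` with `s ∣ 2Cw₁ − Bw₂` and `s ∣ −Bw₁ + 2Aw₂`, i.e. `adj(M)w = s·u`, `u ∈ ℤ²`. Then
`t = ā r̄ u` solves `a·M t = w` in `ℤ/c` (`M u = (M adj(M) w)/s = r w`), hence
`G(a, c; f, w) = e(−ā r̄² f(u)/c) · G(a, c; f, 0)`.
(For `c` prime to the discriminant this is loc. cit.; the point is that no invertibility of `D`
mod `c` is needed on the lattice.) [cite: AndrianovZhuravlev2015, Ch. 1 §4.3, proof of Proposition 4.5 ((4.13)–(4.14))] -/
theorem binQuadGaussSum_eq_of_dvd_adj (f : BinQF) {r : ℤ} {s : ℕ} (hs : s ≠ 0)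
    (hrs : 4 * f.a * f.c - f.b ^ 2 = r * s) (a abar rbar : ZMod c) (haa : a * abar = 1)
    (hrr : (r : ZMod c) * rbar = 1) (w₁ w₂ u₁ u₂ : ℤ)
    (hu₁ : 2 * f.c * w₁ - f.b * w₂ = s * u₁) (hu₂ : -f.b * w₁ + 2 * f.a * w₂ = s * u₂) :
    binQuadGaussSum c f a w₁ w₂ =
      (ZMod.stdAddChar (-(abar * rbar ^ 2 * ((f.eval u₁ u₂ : ℤ) : ZMod c))) : ℂ) *
        binQuadGaussSum c f a 0 0 := by
  -- `M u = r w` over `ℤ`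
  have hs' : (s : ℤ) ≠ 0 := Int.natCast_ne_zero.mpr hs
  have hM1 : 2 * f.a * u₁ + f.b * u₂ = r * w₁ := by
    have h := gram_mul_adj_fst f.a f.b f.c w₁ w₂
    rw [hu₁, hu₂, hrs] at h
    have h' : (s : ℤ) * (2 * f.a * u₁ + f.b * u₂) = (s : ℤ) * (r * w₁) := by linear_combination h
    exact mul_left_cancel₀ hs' h'
  have hM2 : f.b * u₁ + 2 * f.c * u₂ = r * w₂ := by
    have h := gram_mul_adj_snd f.a f.b f.c w₁ w₂
    rw [hu₁, hu₂, hrs] at h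
    have h' : (s : ℤ) * (f.b * u₁ + 2 * f.c * u₂) = (s : ℤ) * (r * w₂) := by linear_combination h
    exact mul_left_cancel₀ hs' h'
  have hM1' : (2 * (f.a : ZMod c) * u₁ + (f.b : ZMod c) * u₂) = (r : ZMod c) * w₁ := by
    exact_mod_cast congrArg (Int.cast (R := ZMod c)) hM1
  have hM2' : ((f.b : ZMod c) * u₁ + 2 * (f.c : ZMod c) * u₂) = (r : ZMod c) * w₂ := by
    exact_mod_cast congrArg (Int.cast (R := ZMod c)) hM2
  -- the solution `t = ā r̄ u`
  have h1 : a * (2 * (f.a : ZMod c) * (abar * rbar * u₁) + (f.b : ZMod c) * (abar * rbar * u₂)) =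
      (w₁ : ZMod c) := by
    linear_combination (a * abar * rbar) * hM1' + ((r : ZMod c) * rbar * (w₁ : ZMod c)) * haa +
      (w₁ : ZMod c) * hrr
  have h2 : a * ((f.b : ZMod c) * (abar * rbar * u₁) + 2 * (f.c : ZMod c) * (abar * rbar * u₂)) =
      (w₂ : ZMod c) := by
    linear_combination (a * abar * rbar) * hM2' + ((r : ZMod c) * rbar * (w₂ : ZMod c)) * haa +
      (w₂ : ZMod c) * hrr
  rw [binQuadGaussSum_eq_stdAddChar_mul_of_gram_solution f a w₁ w₂ _ _ h1 h2]
  have harg : -(a * ((f.a : ZMod c) * (abar * rbar * u₁) ^ 2 +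
      (f.b : ZMod c) * (abar * rbar * u₁) * (abar * rbar * u₂) + (f.c : ZMod c) * (abar * rbar * u₂) ^ 2)) =
      -(abar * rbar ^ 2 * ((f.eval u₁ u₂ : ℤ) : ZMod c)) := by
    rw [BinQF.eval]
    push_cast
    linear_combination (-(abar * rbar ^ 2 *
      ((f.a : ZMod c) * u₁ ^ 2 + (f.b : ZMod c) * u₁ * u₂ + (f.c : ZMod c) * u₂ ^ 2))) * haa
  rw [harg]

/-- On the lattice, `s ∣ f̃(w)` and `f(adj(M)w/s) = r · (f̃(w)/s)` when `(r, s) = 1`: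
from `s²·f(u) = f(adj(M)w) = (4AC − B²)·f̃(w) = r s·f̃(w)` — the integrality of the values of the
form `f̃/s` on the lattice `{w : s ∣ adj(M)w}` (the form attached to the transformed theta series
at a cusp with `(c, q) = s`, `r = q/s`). [cite: ConreyIwaniec2002, §3 (3.16)–(3.18)] -/
theorem dvd_adjEval_and_eval_eq (f : BinQF) {r : ℤ} {s : ℕ} (hs : s ≠ 0)
    (hrs : 4 * f.a * f.c - f.b ^ 2 = r * s) (hcop : IsCoprime r (s : ℤ)) (w₁ w₂ u₁ u₂ : ℤ)
    (hu₁ : 2 * f.c * w₁ - f.b * w₂ = s * u₁) (hu₂ : -f.b * w₁ + 2 * f.a * w₂ = s * u₂) :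
    (s : ℤ) ∣ BinQF.eval ⟨f.c, -f.b, f.a⟩ w₁ w₂ ∧
      f.eval u₁ u₂ = r * (BinQF.eval ⟨f.c, -f.b, f.a⟩ w₁ w₂ / s) := by
  have hs' : (s : ℤ) ≠ 0 := Int.natCast_ne_zero.mpr hs
  have hev : BinQF.eval ⟨f.c, -f.b, f.a⟩ w₁ w₂ = f.c * w₁ ^ 2 - f.b * w₁ * w₂ + f.a * w₂ ^ 2 := by
    rw [BinQF.eval]; ring
  -- `s² f(u) = r s f̃(w)`, hence `s f(u) = r f̃(w)`
  have h0 : (s : ℤ) ^ 2 * f.eval u₁ u₂ = r * s * (f.c * w₁ ^ 2 - f.b * w₁ * w₂ + f.a * w₂ ^ 2) := by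
    have h := eval_adj f.a f.b f.c w₁ w₂
    rw [hu₁, hu₂, hrs] at h
    rw [BinQF.eval]
    linear_combination h
  have h1 : (s : ℤ) * f.eval u₁ u₂ = r * (f.c * w₁ ^ 2 - f.b * w₁ * w₂ + f.a * w₂ ^ 2) := by
    have h' : (s : ℤ) * ((s : ℤ) * f.eval u₁ u₂) =
        (s : ℤ) * (r * (f.c * w₁ ^ 2 - f.b * w₁ * w₂ + f.a * w₂ ^ 2)) := by linear_combination h0
    exact mul_left_cancel₀ hs' h'
  have hdvd : (s : ℤ) ∣ f.c * w₁ ^ 2 - f.b * w₁ * w₂ + f.a * w₂ ^ 2 := by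
    have : (s : ℤ) ∣ r * (f.c * w₁ ^ 2 - f.b * w₁ * w₂ + f.a * w₂ ^ 2) := ⟨_, h1.symm⟩
    exact hcop.symm.dvd_of_dvd_mul_left this
  refine ⟨by rwa [hev], ?_⟩
  obtain ⟨m, hm⟩ := hdvd
  rw [hev, hm, Int.mul_ediv_cancel_left _ hs']
  have h2 : (s : ℤ) * f.eval u₁ u₂ = (s : ℤ) * (r * m) := by rw [h1, hm]; ring
  exact mul_left_cancel₀ hs' h2

/-- **The lattice case, phase in terms of the adjoint form.** Under the hypotheses of
`binQuadGaussSum_eq_of_dvd_adj` and `(r, s) = 1`: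
`G(a, c; f, w) = e(−ā r̄ · (f̃(w)/s) / c) · G(a, c; f, 0)`, `f̃ = (C, −B, A)`, `s ∣ f̃(w)` —
the phase `e(−d·f'(w))` with `d = ā r̄` and `f' = f̃/s` on the lattice (Conrey–Iwaniec's
`d ≡ (ar)‾ (mod c)`, (3.16)). [cite: ConreyIwaniec2002, §3 (3.16)–(3.17)] -/
theorem binQuadGaussSum_eq_of_dvd_adj' (f : BinQF) {r : ℤ} {s : ℕ} (hs : s ≠ 0)
    (hrs : 4 * f.a * f.c - f.b ^ 2 = r * s) (hcop : IsCoprime r (s : ℤ)) (a abar rbar : ZMod c)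
    (haa : a * abar = 1) (hrr : (r : ZMod c) * rbar = 1) (w₁ w₂ : ℤ)
    (hw₁ : (s : ℤ) ∣ 2 * f.c * w₁ - f.b * w₂) (hw₂ : (s : ℤ) ∣ -f.b * w₁ + 2 * f.a * w₂) :
    binQuadGaussSum c f a w₁ w₂ =
      (ZMod.stdAddChar
          (-(abar * rbar * ((BinQF.eval ⟨f.c, -f.b, f.a⟩ w₁ w₂ / s : ℤ) : ZMod c))) : ℂ) *
        binQuadGaussSum c f a 0 0 := by
  obtain ⟨u₁, hu₁⟩ := hw₁
  obtain ⟨u₂, hu₂⟩ := hw₂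
  rw [binQuadGaussSum_eq_of_dvd_adj f hs hrs a abar rbar haa hrr w₁ w₂ u₁ u₂ hu₁ hu₂,
    (dvd_adjEval_and_eval_eq f hs hrs hcop w₁ w₂ u₁ u₂ hu₁ hu₂).2]
  have harg : -(abar * rbar ^ 2 * (((r * (BinQF.eval ⟨f.c, -f.b, f.a⟩ w₁ w₂ / s) : ℤ) : ZMod c))) =
      -(abar * rbar * ((BinQF.eval ⟨f.c, -f.b, f.a⟩ w₁ w₂ / s : ℤ) : ZMod c)) := by
    push_cast
    linear_combination (-(abar * rbar *
      ((BinQF.eval ⟨f.c, -f.b, f.a⟩ w₁ w₂ / s : ℤ) : ZMod c))) * hrr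
  rw [harg]

/-! ### Vanishing off the lattice -/

/-- `e(x/c) = 1` only for `x = 0` in `ℤ/c` (injectivity of `ZMod.stdAddChar`). [folklore] -/
private theorem stdAddChar_eq_one_iff (x : ZMod c) : (ZMod.stdAddChar x : ℂ) = 1 ↔ x = 0 := by
  constructor
  · intro h
    have h' : (ZMod.stdAddChar x : ℂ) = ZMod.stdAddChar (0 : ZMod c) := by
      rw [h, AddChar.map_zero_eq_one]
    exact ZMod.injective_stdAddChar h'
  · rintro rfl
    exact AddChar.map_zero_eq_one _

/-- A sum invariant under a translation that multiplies it by `e ≠ 1` vanishes: if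
`S = e·S` with `e ≠ 1` then `S = 0`. [folklore] -/
private theorem eq_zero_of_eq_mul_self {e S : ℂ} (he : e ≠ 1) (h : S = e * S) : S = 0 := by
  have : (1 - e) * S = 0 := by linear_combination h
  rcases mul_eq_zero.mp this with h1 | h1
  · exact absurd (by linear_combination -h1) he
  · exact h1

/-- **Vanishing off the lattice.** Let `p` be a common divisor of `c` and `D = B² − 4AC`
(a prime in the application, but any `p` works), and let `w ∈ ℤ²` with `p ∤ 2Cw₁ − Bw₂`. Then `G(a, c; f, w) = 0` for every numerator `a`:
with `u = (2C, −B)` (the first column of `adj M`) one has `M u = (−D, 0)`, `f(u) = −C·D`, so for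
`τ = c/p` the translation `v ↦ v + τu` satisfies `a f(v + τu) ≡ a f(v) (mod c)` while
`w·(v + τu) = w·v + τ(2Cw₁ − Bw₂)`, and `e(τ(2Cw₁ − Bw₂)/c) = e((2Cw₁ − Bw₂)/p) ≠ 1`.
(The mechanism behind the support `2Aw₂ ≡ Bw₁ (mod s)` of the inverted theta series at a cusp
with `(c, D) > 1`.) [cite: ConreyIwaniec2002, §3 (3.16)–(3.21)] -/
theorem binQuadGaussSum_eq_zero_of_dvd_fst (f : BinQF) {p : ℕ} (hpc : p ∣ c)
    (hpD : (p : ℤ) ∣ f.disc) (a : ZMod c) (w₁ w₂ : ℤ) (hw : ¬ (p : ℤ) ∣ 2 * f.c * w₁ - f.b * w₂) :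
    binQuadGaussSum c f a w₁ w₂ = 0 := by
  obtain ⟨τ, hτ⟩ := hpc
  obtain ⟨δ, hδ⟩ := hpD
  -- the translation vector `τ·u`, `u = (2C, −B)`
  set t₁ : ZMod c := (τ : ZMod c) * (2 * (f.c : ZMod c)) with ht₁
  set t₂ : ZMod c := (τ : ZMod c) * (-(f.b : ZMod c)) with ht₂
  have hc0 : ((p : ZMod c) * (τ : ZMod c)) = 0 := by
    have h0 : ((p * τ : ℕ) : ZMod c) = 0 := by rw [← hτ]; exact ZMod.natCast_self c
    push_cast at h0
    exact h0
  -- `D = p δ` in `ZMod c`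
  have hD : ((f.b : ZMod c) ^ 2 - 4 * (f.a : ZMod c) * (f.c : ZMod c)) = (p : ZMod c) * (δ : ZMod c) := by
    have := congrArg (Int.cast (R := ZMod c)) hδ
    rw [BinQF.disc] at this; push_cast at this; exact this
  -- `a f(v + τu) + w·(v + τu) = a f(v) + w·v + τ(2Cw₁ − Bw₂)` in `ZMod c`
  have key : ∀ v : ZMod c × ZMod c,
      a * ((f.a : ZMod c) * (v.1 + t₁) ^ 2 + (f.b : ZMod c) * (v.1 + t₁) * (v.2 + t₂) +
          (f.c : ZMod c) * (v.2 + t₂) ^ 2) + (w₁ : ZMod c) * (v.1 + t₁) + (w₂ : ZMod c) * (v.2 + t₂) =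
        a * ((f.a : ZMod c) * v.1 ^ 2 + (f.b : ZMod c) * v.1 * v.2 + (f.c : ZMod c) * v.2 ^ 2) +
          (w₁ : ZMod c) * v.1 + (w₂ : ZMod c) * v.2 +
          (τ : ZMod c) * (2 * (f.c : ZMod c) * (w₁ : ZMod c) - (f.b : ZMod c) * (w₂ : ZMod c)) := by
    intro v
    rw [ht₁, ht₂]
    linear_combination (-(a * v.1 * (τ : ZMod c)) - a * (τ : ZMod c) ^ 2 * (f.c : ZMod c)) * hD +
      (-(a * v.1 + a * (τ : ZMod c) * (f.c : ZMod c)) * (δ : ZMod c)) * hc0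
  -- the multiplier `e(τ(2Cw₁ − Bw₂)/c) ≠ 1`
  set e : ℂ := (ZMod.stdAddChar
    ((τ : ZMod c) * (2 * (f.c : ZMod c) * (w₁ : ZMod c) - (f.b : ZMod c) * (w₂ : ZMod c))) : ℂ) with he
  have hne : e ≠ 1 := by
    rw [he, Ne, stdAddChar_eq_one_iff]
    intro h0
    have h0' : (((τ : ℤ) * (2 * f.c * w₁ - f.b * w₂) : ℤ) : ZMod c) = 0 := by
      push_cast; exact h0
    rw [ZMod.intCast_zmod_eq_zero_iff_dvd, hτ] at h0'
    push_cast at h0'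
    have hτ0 : (τ : ℤ) ≠ 0 := by
      rintro hτz
      have hτn : τ = 0 := by exact_mod_cast hτz
      exact NeZero.ne c (by rw [hτ, hτn, mul_zero])
    rw [mul_comm (τ : ℤ) (2 * f.c * w₁ - f.b * w₂)] at h0'
    exact hw ((mul_dvd_mul_iff_right hτ0).mp h0')
  refine eq_zero_of_eq_mul_self hne ?_
  rw [binQuadGaussSum_def, Finset.mul_sum]
  symm
  refine Fintype.sum_equiv (Equiv.addRight (t₁, t₂)) _ _ fun v ↦ ?_
  rw [Equiv.coe_addRight, Prod.fst_add, Prod.snd_add, key v, he, ← AddChar.map_add_eq_mul]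
  congr 1
  ring

/-- **Vanishing off the lattice**, second coordinate: if a common divisor `p` of `c` and `D`
does not divide `−Bw₁ + 2Aw₂`, then `G(a, c; f, w) = 0` (the same with `u = (−B, 2A)`, `M u = (0, −D)`,
`f(u) = −A·D`). [cite: ConreyIwaniec2002, §3 (3.16)–(3.21)] -/
theorem binQuadGaussSum_eq_zero_of_dvd_snd (f : BinQF) {p : ℕ} (hpc : p ∣ c)
    (hpD : (p : ℤ) ∣ f.disc) (a : ZMod c) (w₁ w₂ : ℤ) (hw : ¬ (p : ℤ) ∣ -f.b * w₁ + 2 * f.a * w₂) :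
    binQuadGaussSum c f a w₁ w₂ = 0 := by
  -- swap the variables: `G(a,c;(C,B,A),(w₂,w₁)) = G(a,c;f,w)`
  have hswap : binQuadGaussSum c ⟨f.c, f.b, f.a⟩ a w₂ w₁ = binQuadGaussSum c f a w₁ w₂ := by
    rw [binQuadGaussSum_def, binQuadGaussSum_def]
    refine Fintype.sum_equiv (Equiv.prodComm _ _) _ _ fun v ↦ ?_
    simp only [Equiv.prodComm_apply, Prod.fst_swap, Prod.snd_swap]
    congr 1
    ring
  rw [← hswap]
  refine binQuadGaussSum_eq_zero_of_dvd_fst ⟨f.c, f.b, f.a⟩ hpc ?_ a w₂ w₁ ?_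
  · rw [BinQF.disc] at hpD ⊢
    simpa [mul_comm, mul_assoc, mul_left_comm] using hpD
  · intro h
    apply hw
    have : -f.b * w₁ + 2 * f.a * w₂ = 2 * f.a * w₂ - f.b * w₁ := by ring
    rw [this]
    exact h

/-- For a squarefree `s`: `s ∣ m` as soon as every prime factor of `s` divides `m`. [folklore] -/
private theorem natCast_dvd_of_squarefree_of_forall_prime {s : ℕ} (hs : Squarefree s) {m : ℤ}
    (h : ∀ p : ℕ, p.Prime → p ∣ s → (p : ℤ) ∣ m) : (s : ℤ) ∣ m := by
  rw [← Int.natAbs_dvd_natAbs, Int.natAbs_natCast]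
  rcases eq_or_ne m.natAbs 0 with hn | hn
  · rw [hn]; exact dvd_zero _
  have hs0 : s ≠ 0 := hs.ne_zero
  rw [← Nat.factorization_le_iff_dvd hs0 hn]
  intro p
  by_cases hp : p.Prime
  · by_cases hps : p ∣ s
    · have h1 : s.factorization p ≤ 1 := (Nat.squarefree_iff_factorization_le_one hs0).mp hs p
      have h2 : 1 ≤ m.natAbs.factorization p := (hp.dvd_iff_one_le_factorization hn).mp (by
        have := h p hp hps
        rwa [← Int.natAbs_dvd_natAbs, Int.natAbs_natCast] at this)
      omega
    · rw [Nat.factorization_eq_zero_of_not_dvd hps]; exact Nat.zero_le _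
  · rw [Nat.factorization_eq_zero_of_not_prime _ hp]; exact Nat.zero_le _

/-- **Vanishing off the lattice, squarefree form.** For a squarefree `s` with `s ∣ c` and
`s ∣ D`: if `¬(s ∣ 2Cw₁ − Bw₂ ∧ s ∣ −Bw₁ + 2Aw₂)` then `G(a, c; f, w) = 0` for every `a`
(some prime `p ∣ s` misses one of the two coordinates of `adj(M)w`).
[cite: ConreyIwaniec2002, §3 (3.16)–(3.21)] -/
theorem binQuadGaussSum_eq_zero_of_not_dvd_adj (f : BinQF) {s : ℕ} (hsq : Squarefree s)
    (hsc : s ∣ c) (hsD : (s : ℤ) ∣ f.disc) (a : ZMod c) (w₁ w₂ : ℤ)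
    (hw : ¬ ((s : ℤ) ∣ 2 * f.c * w₁ - f.b * w₂ ∧ (s : ℤ) ∣ -f.b * w₁ + 2 * f.a * w₂)) :
    binQuadGaussSum c f a w₁ w₂ = 0 := by
  by_contra hne
  apply hw
  constructor
  · refine natCast_dvd_of_squarefree_of_forall_prime hsq fun p hp hps ↦ ?_
    by_contra hnd
    exact hne (binQuadGaussSum_eq_zero_of_dvd_fst f (hps.trans hsc)
      ((Int.natCast_dvd_natCast.mpr hps).trans hsD) a w₁ w₂ hnd)
  · refine natCast_dvd_of_squarefree_of_forall_prime hsq fun p hp hps ↦ ?_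
    by_contra hnd
    exact hne (binQuadGaussSum_eq_zero_of_dvd_snd f (hps.trans hsc)
      ((Int.natCast_dvd_natCast.mpr hps).trans hsD) a w₁ w₂ hnd)

end Literature.NumberTheory.ModularForms

end
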